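import Summits.QuantumFields.BalabanUV.Beta.GAN24.BornBorderContactLineage

/-!
# `BalabanUV.Beta.GAN24.BornBorderContactPairCount` — binder row G-an2-4 / (CONV-C), CT-ROUTE, «(V-C)-DIFF» module (C⁰): **THE ARITHMETIC OF THE PAIR COUNT** at `d = 3` — the pair cell
# polynomial of (B) at the route's letters and the weighted difference of the two channels' pair bounds against leaf-02 g48's unit count `BornLambdaContactLineage.units_le`

NOT IN PRINT; OUR BOOKKEEPING (G-an2-4 formalisation swarm → CRUX TEAM (2), leaf prover `b2b-balaban-gan24-formalise-leaf-03`, gen 56; «(V-C)-DIFF» INTENT journal `CLAIMS.log`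
[LEAF03-G56-ONLINE] ∕ [LEAF03-G56-A1]).  [folklore] real arithmetic ONLY (no lattice object): the inputs are two abstract real numbers `FM`, `MF` bounded by the shapes of (B)
`ContactBorderPairEntryBound.abs_contact_border_fm∕mf_pair_le` at `K_B = C₁·u₀`, `α_g = 8·Lc·C₁·u₀`, `K_Δ = c_Δ·u₀`, `α_Δ = 8·Lc·c_Δ·u₀`, tents `T_b·q₇`, `T_Δ·q₇`
(`u₀ = (Lc^{5(n+1)})⁻¹`, `q₇ = ((Lc^n)^7)⁻¹`); over (C2) `BornBorderContactLineage.exp_recenter_right∕left_le`, leaf-02's `ContactLambdaCellBound.exp_supNorm_add_le_exp_l1` and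
`BornLambdaContactLineage.units_le` BY NAME.  0 `def`, 0 cited facts, 0 `def … : Prop`, 0 sorry; NO estimate of Bałaban's.  Kept apart from (C) `BornBorderContactPairLineage` so that
each declaration elaborates within the default heartbeat budget.  HONEST FRAMING (cell contract, verbatim): «discharging `BetaPertH` makes Bałaban's UV stability UNCONDITIONAL — a real
milestone — but is NOT existence of continuum YM on T⁴ and NOT the Clay problem.»  Discharges nothing: NOT hBdev, NOT (hS, hSall), NEVER «G-an2-4 closed», NOT (CONV-C), NOT D1, NOT
`BetaPertH`.  HONEST DEPENDENCY: continuum YM on T⁴ ⇐ BetaPertH ∧ nine spine estimates (0/9 proved); BetaPertH ⇐ (D1) ∧ (D4) ∧ CAP+tail; G-an2-4 gates asym, D1 and NE2/3/4.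

WHAT IS PROVED.
* `polyPair_le` — `T_b·(…) + T_Δ·(…) + T_b·(…) ≤ (2·T_b·C₁·c_Δ + T_Δ·C₁²)·u²·((n+1)·(Lc·(32 + 288·Lc + 512·Lc²)))` (`A(α) = 2α + 2α·Lc·n`, `P(a,b) = 4ab + 8ab·Lc·n`).
* `weighted_pair_le_of_cells` — `|cE·Lc^8|^{n+1}·|cVH|·|MF − FM| ≤ |cVH|·C_pair·((n+1)·(Lc⁻¹)^{n+1})·e^{−(κ∕96)(|x−u′|₁+|z−u′|₁)}` at the pin `|cE| ≤ Lc^4`,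
  `C_pair = 2·Lc^3·((Lc^4)⁻¹·(4·(e^{8κ})²·Cnt)·((2·T_b·C₁·c_Δ + T_Δ·C₁²)·(Lc·(32 + 288·Lc + 512·Lc²)))·Zl 4 (κ∕16))`.
-/

open Literature.MathematicalPhysics.QuantumFieldTheory
open Literature.MathematicalPhysics.QuantumFieldTheory.Balaban1983to89
open Literature.MathematicalPhysics.QuantumFieldTheory.Balaban1983to89.Beta
open B4ContourShift (supNorm supNorm_nonneg)
open B12Sec2to5 (l1 l1_nonneg)
open ExpKernelCalculus (Zl Zl_nonneg)
open AffineAveraging (Site)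
open AveragingHessianKernels (ell)
open Summit.QuantumFields.BalabanUV.Beta.GAN24.ContactLambdaCellBound (exp_supNorm_add_le_exp_l1)
open Summit.QuantumFields.BalabanUV.Beta.GAN24.BornLambdaContactLineage (units_le)
open Summit.QuantumFields.BalabanUV.Beta.GAN24.BornBorderContactLineage (exp_recenter_right_le exp_recenter_left_le)

namespace Summit.QuantumFields.BalabanUV.Beta.GAN24.BornBorderContactPairCount

/-- [folklore] **THE PAIR CELL POLYNOMIAL** of (B) at `K_B = C₁·u`, `α_g = 8·Lc·C₁·u`, `K_Δ = c_Δ·u`, `α_Δ = 8·Lc·c_Δ·u` (all of `T_b, T_Δ, C₁, c_Δ, u, n ≥ 0`):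
`T_b·(K_B·A(α_Δ) + P(α_Δ,α_g) + K_Δ·A(α_g)) + T_Δ·(K_B·A(α_g) + P(α_g,α_g) + K_B·A(α_g)) + T_b·(K_Δ·A(α_g) + P(α_g,α_Δ) + K_B·A(α_Δ))`
`≤ (2·T_b·C₁·c_Δ + T_Δ·C₁²)·u²·((n+1)·(Lc·(32 + 288·Lc + 512·Lc²)))` (`A(α) = 2α + 2α·Lc·n`, `P(a,b) = 4ab + 8ab·Lc·n`). -/
theorem polyPair_le {Lc : ℕ} {Tb TΔ C₁ cΔ u : ℝ} (hTb : 0 ≤ Tb) (hTΔ : 0 ≤ TΔ) (hC₁ : 0 ≤ C₁) (hcΔ : 0 ≤ cΔ) (n : ℕ) :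
    Tb * ((C₁ * u) * (2 * (8 * (Lc : ℝ) * cΔ * u) + 2 * (8 * (Lc : ℝ) * cΔ * u) * Lc * n)
          + (4 * ((8 * (Lc : ℝ) * cΔ * u) * (8 * (Lc : ℝ) * C₁ * u)) + 2 * (4 * ((8 * (Lc : ℝ) * cΔ * u) * (8 * (Lc : ℝ) * C₁ * u))) * Lc * n)
          + (cΔ * u) * (2 * (8 * (Lc : ℝ) * C₁ * u) + 2 * (8 * (Lc : ℝ) * C₁ * u) * Lc * n))
      + TΔ * ((C₁ * u) * (2 * (8 * (Lc : ℝ) * C₁ * u) + 2 * (8 * (Lc : ℝ) * C₁ * u) * Lc * n)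
          + (4 * ((8 * (Lc : ℝ) * C₁ * u) * (8 * (Lc : ℝ) * C₁ * u)) + 2 * (4 * ((8 * (Lc : ℝ) * C₁ * u) * (8 * (Lc : ℝ) * C₁ * u))) * Lc * n)
          + (C₁ * u) * (2 * (8 * (Lc : ℝ) * C₁ * u) + 2 * (8 * (Lc : ℝ) * C₁ * u) * Lc * n))
      + Tb * ((cΔ * u) * (2 * (8 * (Lc : ℝ) * C₁ * u) + 2 * (8 * (Lc : ℝ) * C₁ * u) * Lc * n)
          + (4 * ((8 * (Lc : ℝ) * C₁ * u) * (8 * (Lc : ℝ) * cΔ * u)) + 2 * (4 * ((8 * (Lc : ℝ) * C₁ * u) * (8 * (Lc : ℝ) * cΔ * u))) * Lc * n)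
          + (C₁ * u) * (2 * (8 * (Lc : ℝ) * cΔ * u) + 2 * (8 * (Lc : ℝ) * cΔ * u) * Lc * n))
      ≤ (2 * Tb * C₁ * cΔ + TΔ * C₁ ^ 2) * u ^ 2 * (((n : ℝ) + 1) * ((Lc : ℝ) * (32 + 288 * Lc + 512 * (Lc : ℝ) ^ 2))) := by
  have hL : (0 : ℝ) ≤ (Lc : ℝ) := Nat.cast_nonneg _
  have hn : (0 : ℝ) ≤ n := Nat.cast_nonneg _
  have hA : 0 ≤ (2 * Tb * C₁ * cΔ + TΔ * C₁ ^ 2) * u ^ 2 := by positivity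
  -- exact expansion: every bracket is the SAME polynomial `R(n) = 32Lc + 256Lc² + (32Lc² + 512Lc³)·n`
  have e : Tb * ((C₁ * u) * (2 * (8 * (Lc : ℝ) * cΔ * u) + 2 * (8 * (Lc : ℝ) * cΔ * u) * Lc * n)
          + (4 * ((8 * (Lc : ℝ) * cΔ * u) * (8 * (Lc : ℝ) * C₁ * u)) + 2 * (4 * ((8 * (Lc : ℝ) * cΔ * u) * (8 * (Lc : ℝ) * C₁ * u))) * Lc * n)
          + (cΔ * u) * (2 * (8 * (Lc : ℝ) * C₁ * u) + 2 * (8 * (Lc : ℝ) * C₁ * u) * Lc * n))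
      + TΔ * ((C₁ * u) * (2 * (8 * (Lc : ℝ) * C₁ * u) + 2 * (8 * (Lc : ℝ) * C₁ * u) * Lc * n)
          + (4 * ((8 * (Lc : ℝ) * C₁ * u) * (8 * (Lc : ℝ) * C₁ * u)) + 2 * (4 * ((8 * (Lc : ℝ) * C₁ * u) * (8 * (Lc : ℝ) * C₁ * u))) * Lc * n)
          + (C₁ * u) * (2 * (8 * (Lc : ℝ) * C₁ * u) + 2 * (8 * (Lc : ℝ) * C₁ * u) * Lc * n))
      + Tb * ((cΔ * u) * (2 * (8 * (Lc : ℝ) * C₁ * u) + 2 * (8 * (Lc : ℝ) * C₁ * u) * Lc * n)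
          + (4 * ((8 * (Lc : ℝ) * C₁ * u) * (8 * (Lc : ℝ) * cΔ * u)) + 2 * (4 * ((8 * (Lc : ℝ) * C₁ * u) * (8 * (Lc : ℝ) * cΔ * u))) * Lc * n)
          + (C₁ * u) * (2 * (8 * (Lc : ℝ) * cΔ * u) + 2 * (8 * (Lc : ℝ) * cΔ * u) * Lc * n))
      = ((2 * Tb * C₁ * cΔ + TΔ * C₁ ^ 2) * u ^ 2) * (32 * Lc + 256 * (Lc : ℝ) ^ 2 + (32 * (Lc : ℝ) ^ 2 + 512 * (Lc : ℝ) ^ 3) * n) := by ring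
  rw [e]
  refine mul_le_mul_of_nonneg_left ?_ hA
  nlinarith [mul_nonneg hL hn, mul_nonneg (mul_nonneg hL hL) hn, mul_nonneg (mul_nonneg (mul_nonneg hL hL) hL) hn, mul_nonneg hL hL,
    mul_nonneg (mul_nonneg hL hL) hL]


/-- [folklore] **THE ARITHMETIC OF THE PAIR COUNT** (pure real algebra; `d = 3` exponents): if the fm pair and the mf pair of cells are bounded by (B)'s shapes with the letters
`K_B = C₁·u₀`, `α_g = 8·Lc·C₁·u₀`, `K_Δ = c_Δ·u₀`, `α_Δ = 8·Lc·c_Δ·u₀`, tents `T_b·q₇`, `T_Δ·q₇` (`u₀ = (Lc^{5(n+1)})⁻¹`, `q₇ = ((Lc^n)^7)⁻¹`) and envelopes centred at `z` resp. `x`, then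
the weighted difference is below `|cVH|·C_pair·((n+1)·(Lc⁻¹)^{n+1})·e^{−(κ∕96)(|x−u′|₁+|z−u′|₁)}` — §1, (C2)'s re-centring, leaf-02's `units_le`. -/
theorem weighted_pair_le_of_cells {Lc : ℕ} [NeZero Lc] {cE cVH C₁ cΔ Tb TΔ κ FM MF : ℝ} {n : ℕ} (hcE : |cE| ≤ (Lc : ℝ) ^ 4)
    (hC₁ : 0 ≤ C₁) (hcΔ : 0 ≤ cΔ) (hTb : 0 ≤ Tb) (hTΔ : 0 ≤ TΔ) (hκ : 0 < κ) (x z u' : Site (3 + 1))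
    (hfm : |FM| ≤ ((Lc : ℝ) ^ (3 + 1))⁻¹ *
          ((((3 : ℝ) + 1) * (Real.exp (2 * ((3 : ℝ) + 1) * κ) ^ 2 *
              (((2 * Lc : ℕ) : ℝ) ^ (3 + 1) * (((3 + 1 : ℕ) : ℝ) * ((Lc : ℝ) ^ (3 + 1) * (ell (3 + 1) Lc : ℝ))))))
            * ((Tb * ((((Lc : ℝ) ^ n) ^ (2 * 3 + 1))⁻¹)) * ((C₁ * ((Lc : ℝ) ^ (5 * (n + 1)))⁻¹) * (2 * (8 * (Lc : ℝ) * cΔ * ((Lc : ℝ) ^ (5 * (n + 1)))⁻¹) + 2 * (8 * (Lc : ℝ) * cΔ * ((Lc : ℝ) ^ (5 * (n + 1)))⁻¹) * Lc * n)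
                  + (4 * ((8 * (Lc : ℝ) * cΔ * ((Lc : ℝ) ^ (5 * (n + 1)))⁻¹) * (8 * (Lc : ℝ) * C₁ * ((Lc : ℝ) ^ (5 * (n + 1)))⁻¹))
                    + 2 * (4 * ((8 * (Lc : ℝ) * cΔ * ((Lc : ℝ) ^ (5 * (n + 1)))⁻¹) * (8 * (Lc : ℝ) * C₁ * ((Lc : ℝ) ^ (5 * (n + 1)))⁻¹))) * Lc * n)
                  + (cΔ * ((Lc : ℝ) ^ (5 * (n + 1)))⁻¹) * (2 * (8 * (Lc : ℝ) * C₁ * ((Lc : ℝ) ^ (5 * (n + 1)))⁻¹) + 2 * (8 * (Lc : ℝ) * C₁ * ((Lc : ℝ) ^ (5 * (n + 1)))⁻¹) * Lc * n))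
              + (TΔ * ((((Lc : ℝ) ^ n) ^ (2 * 3 + 1))⁻¹)) * ((C₁ * ((Lc : ℝ) ^ (5 * (n + 1)))⁻¹) * (2 * (8 * (Lc : ℝ) * C₁ * ((Lc : ℝ) ^ (5 * (n + 1)))⁻¹) + 2 * (8 * (Lc : ℝ) * C₁ * ((Lc : ℝ) ^ (5 * (n + 1)))⁻¹) * Lc * n)
                  + (4 * ((8 * (Lc : ℝ) * C₁ * ((Lc : ℝ) ^ (5 * (n + 1)))⁻¹) * (8 * (Lc : ℝ) * C₁ * ((Lc : ℝ) ^ (5 * (n + 1)))⁻¹))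
                    + 2 * (4 * ((8 * (Lc : ℝ) * C₁ * ((Lc : ℝ) ^ (5 * (n + 1)))⁻¹) * (8 * (Lc : ℝ) * C₁ * ((Lc : ℝ) ^ (5 * (n + 1)))⁻¹))) * Lc * n)
                  + (C₁ * ((Lc : ℝ) ^ (5 * (n + 1)))⁻¹) * (2 * (8 * (Lc : ℝ) * C₁ * ((Lc : ℝ) ^ (5 * (n + 1)))⁻¹) + 2 * (8 * (Lc : ℝ) * C₁ * ((Lc : ℝ) ^ (5 * (n + 1)))⁻¹) * Lc * n))
              + (Tb * ((((Lc : ℝ) ^ n) ^ (2 * 3 + 1))⁻¹)) * ((cΔ * ((Lc : ℝ) ^ (5 * (n + 1)))⁻¹) * (2 * (8 * (Lc : ℝ) * C₁ * ((Lc : ℝ) ^ (5 * (n + 1)))⁻¹) + 2 * (8 * (Lc : ℝ) * C₁ * ((Lc : ℝ) ^ (5 * (n + 1)))⁻¹) * Lc * n)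
                  + (4 * ((8 * (Lc : ℝ) * C₁ * ((Lc : ℝ) ^ (5 * (n + 1)))⁻¹) * (8 * (Lc : ℝ) * cΔ * ((Lc : ℝ) ^ (5 * (n + 1)))⁻¹))
                    + 2 * (4 * ((8 * (Lc : ℝ) * C₁ * ((Lc : ℝ) ^ (5 * (n + 1)))⁻¹) * (8 * (Lc : ℝ) * cΔ * ((Lc : ℝ) ^ (5 * (n + 1)))⁻¹))) * Lc * n)
                  + (C₁ * ((Lc : ℝ) ^ (5 * (n + 1)))⁻¹) * (2 * (8 * (Lc : ℝ) * cΔ * ((Lc : ℝ) ^ (5 * (n + 1)))⁻¹) + 2 * (8 * (Lc : ℝ) * cΔ * ((Lc : ℝ) ^ (5 * (n + 1)))⁻¹) * Lc * n)))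
            * ((((Lc ^ n : ℕ) : ℝ)) ^ (3 + 1) * Zl (3 + 1) (κ / (4 * ((3 : ℝ) + 1))))
            * Real.exp (-(κ / 12) * (supNorm (x - z) + supNorm (u' - z)))))
    (hmf : |MF| ≤ ((Lc : ℝ) ^ (3 + 1))⁻¹ *
          ((((3 : ℝ) + 1) * (Real.exp (2 * ((3 : ℝ) + 1) * κ) ^ 2 *
              (((2 * Lc : ℕ) : ℝ) ^ (3 + 1) * (((3 + 1 : ℕ) : ℝ) * ((Lc : ℝ) ^ (3 + 1) * (ell (3 + 1) Lc : ℝ))))))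
            * ((TΔ * ((((Lc : ℝ) ^ n) ^ (2 * 3 + 1))⁻¹)) * ((C₁ * ((Lc : ℝ) ^ (5 * (n + 1)))⁻¹) * (2 * (8 * (Lc : ℝ) * C₁ * ((Lc : ℝ) ^ (5 * (n + 1)))⁻¹) + 2 * (8 * (Lc : ℝ) * C₁ * ((Lc : ℝ) ^ (5 * (n + 1)))⁻¹) * Lc * n)
                  + (4 * ((8 * (Lc : ℝ) * C₁ * ((Lc : ℝ) ^ (5 * (n + 1)))⁻¹) * (8 * (Lc : ℝ) * C₁ * ((Lc : ℝ) ^ (5 * (n + 1)))⁻¹))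
                    + 2 * (4 * ((8 * (Lc : ℝ) * C₁ * ((Lc : ℝ) ^ (5 * (n + 1)))⁻¹) * (8 * (Lc : ℝ) * C₁ * ((Lc : ℝ) ^ (5 * (n + 1)))⁻¹))) * Lc * n)
                  + (C₁ * ((Lc : ℝ) ^ (5 * (n + 1)))⁻¹) * (2 * (8 * (Lc : ℝ) * C₁ * ((Lc : ℝ) ^ (5 * (n + 1)))⁻¹) + 2 * (8 * (Lc : ℝ) * C₁ * ((Lc : ℝ) ^ (5 * (n + 1)))⁻¹) * Lc * n))
              + (Tb * ((((Lc : ℝ) ^ n) ^ (2 * 3 + 1))⁻¹)) * ((C₁ * ((Lc : ℝ) ^ (5 * (n + 1)))⁻¹) * (2 * (8 * (Lc : ℝ) * cΔ * ((Lc : ℝ) ^ (5 * (n + 1)))⁻¹) + 2 * (8 * (Lc : ℝ) * cΔ * ((Lc : ℝ) ^ (5 * (n + 1)))⁻¹) * Lc * n)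
                  + (4 * ((8 * (Lc : ℝ) * cΔ * ((Lc : ℝ) ^ (5 * (n + 1)))⁻¹) * (8 * (Lc : ℝ) * C₁ * ((Lc : ℝ) ^ (5 * (n + 1)))⁻¹))
                    + 2 * (4 * ((8 * (Lc : ℝ) * cΔ * ((Lc : ℝ) ^ (5 * (n + 1)))⁻¹) * (8 * (Lc : ℝ) * C₁ * ((Lc : ℝ) ^ (5 * (n + 1)))⁻¹))) * Lc * n)
                  + (cΔ * ((Lc : ℝ) ^ (5 * (n + 1)))⁻¹) * (2 * (8 * (Lc : ℝ) * C₁ * ((Lc : ℝ) ^ (5 * (n + 1)))⁻¹) + 2 * (8 * (Lc : ℝ) * C₁ * ((Lc : ℝ) ^ (5 * (n + 1)))⁻¹) * Lc * n))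
              + (Tb * ((((Lc : ℝ) ^ n) ^ (2 * 3 + 1))⁻¹)) * ((cΔ * ((Lc : ℝ) ^ (5 * (n + 1)))⁻¹) * (2 * (8 * (Lc : ℝ) * C₁ * ((Lc : ℝ) ^ (5 * (n + 1)))⁻¹) + 2 * (8 * (Lc : ℝ) * C₁ * ((Lc : ℝ) ^ (5 * (n + 1)))⁻¹) * Lc * n)
                  + (4 * ((8 * (Lc : ℝ) * C₁ * ((Lc : ℝ) ^ (5 * (n + 1)))⁻¹) * (8 * (Lc : ℝ) * cΔ * ((Lc : ℝ) ^ (5 * (n + 1)))⁻¹))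
                    + 2 * (4 * ((8 * (Lc : ℝ) * C₁ * ((Lc : ℝ) ^ (5 * (n + 1)))⁻¹) * (8 * (Lc : ℝ) * cΔ * ((Lc : ℝ) ^ (5 * (n + 1)))⁻¹))) * Lc * n)
                  + (C₁ * ((Lc : ℝ) ^ (5 * (n + 1)))⁻¹) * (2 * (8 * (Lc : ℝ) * cΔ * ((Lc : ℝ) ^ (5 * (n + 1)))⁻¹) + 2 * (8 * (Lc : ℝ) * cΔ * ((Lc : ℝ) ^ (5 * (n + 1)))⁻¹) * Lc * n)))
            * ((((Lc ^ n : ℕ) : ℝ)) ^ (3 + 1) * Zl (3 + 1) (κ / (4 * ((3 : ℝ) + 1))))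
            * Real.exp (-(κ / 12) * (supNorm (z - x) + supNorm (u' - x))))) :
    |cE * (Lc : ℝ) ^ (2 * (3 + 1))| ^ (n + 1) * |cVH| * |MF - FM|
      ≤ |cVH| * (2 * ((Lc : ℝ) ^ 3 * (((Lc : ℝ) ^ (3 + 1))⁻¹ * (((3 : ℝ) + 1) * (Real.exp (2 * ((3 : ℝ) + 1) * κ) ^ 2 *
              (((2 * Lc : ℕ) : ℝ) ^ (3 + 1) * (((3 + 1 : ℕ) : ℝ) * ((Lc : ℝ) ^ (3 + 1) * (ell (3 + 1) Lc : ℝ))))))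
            * ((2 * Tb * C₁ * cΔ + TΔ * C₁ ^ 2) * ((Lc : ℝ) * (32 + 288 * Lc + 512 * (Lc : ℝ) ^ 2)))
            * Zl (3 + 1) (κ / (4 * ((3 : ℝ) + 1))))))
          * ((((n : ℝ) + 1)) * ((Lc : ℝ)⁻¹) ^ (n + 1))
          * Real.exp (-(κ / 12 / 2 / ((3 : ℝ) + 1)) * (l1 (x - u') + l1 (z - u'))) := by
  have hL : (0 : ℝ) < (Lc : ℝ) := Nat.cast_pos.2 (Nat.pos_of_ne_zero (NeZero.ne Lc))
  have hZ : 0 ≤ Zl (3 + 1) (κ / (4 * ((3 : ℝ) + 1))) := Zl_nonneg (by positivity)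
  -- |mf − fm| ≤ |mf| + |fm|
  refine (mul_le_mul_of_nonneg_left ((abs_sub _ _).trans (add_le_add hmf hfm)) (by positivity)).trans ?_
  clear hmf hfm
  -- name the atoms
  set u₀ : ℝ := ((Lc : ℝ) ^ (5 * (n + 1)))⁻¹ with hu₀
  set q7 : ℝ := (((Lc : ℝ) ^ n) ^ (2 * 3 + 1))⁻¹ with hq7
  set K : ℝ := ((3 : ℝ) + 1) * (Real.exp (2 * ((3 : ℝ) + 1) * κ) ^ 2 *
    (((2 * Lc : ℕ) : ℝ) ^ (3 + 1) * (((3 + 1 : ℕ) : ℝ) * ((Lc : ℝ) ^ (3 + 1) * (ell (3 + 1) Lc : ℝ))))) with hKdef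
  set Y4 : ℝ := (((Lc ^ n : ℕ) : ℝ)) ^ (3 + 1) with hY4
  set ZZ : ℝ := Zl (3 + 1) (κ / (4 * ((3 : ℝ) + 1))) with hZZ
  set L3 : ℝ := (Lc : ℝ) * (32 + 288 * Lc + 512 * (Lc : ℝ) ^ 2) with hL3
  set EXP : ℝ := Real.exp (-(κ / 12 / 2 / ((3 : ℝ) + 1)) * (l1 (x - u') + l1 (z - u'))) with hEXP
  set W : ℝ := |cE * (Lc : ℝ) ^ (2 * (3 + 1))| ^ (n + 1) with hW
  have hu₀0 : 0 ≤ u₀ := by positivity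
  have hq70 : 0 ≤ q7 := by positivity
  have hK0 : 0 ≤ K := by positivity
  have hY40 : 0 ≤ Y4 := by positivity
  have hL30 : 0 ≤ L3 := by positivity
  have hEXP0 : 0 ≤ EXP := (Real.exp_pos _).le
  have hW0 : 0 ≤ W := by positivity
  -- the polynomials against §1
  have hP := polyPair_le (Lc := Lc) (u := u₀) (mul_nonneg hTb hq70) (mul_nonneg hTΔ hq70) hC₁ hcΔ n
  have hPP : (2 * (Tb * q7) * C₁ * cΔ + (TΔ * q7) * C₁ ^ 2) * u₀ ^ 2 * (((n : ℝ) + 1) * L3)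
      = (q7 * u₀ ^ 2) * ((2 * Tb * C₁ * cΔ + TΔ * C₁ ^ 2) * (((n : ℝ) + 1) * L3)) := by ring
  have hPfm : (Tb * q7) * ((C₁ * u₀) * (2 * (8 * (Lc : ℝ) * cΔ * u₀) + 2 * (8 * (Lc : ℝ) * cΔ * u₀) * Lc * n)
          + (4 * ((8 * (Lc : ℝ) * cΔ * u₀) * (8 * (Lc : ℝ) * C₁ * u₀)) + 2 * (4 * ((8 * (Lc : ℝ) * cΔ * u₀) * (8 * (Lc : ℝ) * C₁ * u₀))) * Lc * n)
          + (cΔ * u₀) * (2 * (8 * (Lc : ℝ) * C₁ * u₀) + 2 * (8 * (Lc : ℝ) * C₁ * u₀) * Lc * n))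
      + (TΔ * q7) * ((C₁ * u₀) * (2 * (8 * (Lc : ℝ) * C₁ * u₀) + 2 * (8 * (Lc : ℝ) * C₁ * u₀) * Lc * n)
          + (4 * ((8 * (Lc : ℝ) * C₁ * u₀) * (8 * (Lc : ℝ) * C₁ * u₀)) + 2 * (4 * ((8 * (Lc : ℝ) * C₁ * u₀) * (8 * (Lc : ℝ) * C₁ * u₀))) * Lc * n)
          + (C₁ * u₀) * (2 * (8 * (Lc : ℝ) * C₁ * u₀) + 2 * (8 * (Lc : ℝ) * C₁ * u₀) * Lc * n))
      + (Tb * q7) * ((cΔ * u₀) * (2 * (8 * (Lc : ℝ) * C₁ * u₀) + 2 * (8 * (Lc : ℝ) * C₁ * u₀) * Lc * n)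
          + (4 * ((8 * (Lc : ℝ) * C₁ * u₀) * (8 * (Lc : ℝ) * cΔ * u₀)) + 2 * (4 * ((8 * (Lc : ℝ) * C₁ * u₀) * (8 * (Lc : ℝ) * cΔ * u₀))) * Lc * n)
          + (C₁ * u₀) * (2 * (8 * (Lc : ℝ) * cΔ * u₀) + 2 * (8 * (Lc : ℝ) * cΔ * u₀) * Lc * n))
      ≤ (q7 * u₀ ^ 2) * ((2 * Tb * C₁ * cΔ + TΔ * C₁ ^ 2) * (((n : ℝ) + 1) * L3)) := by
    rw [← hPP]; exact hP
  have hPmf : (TΔ * q7) * ((C₁ * u₀) * (2 * (8 * (Lc : ℝ) * C₁ * u₀) + 2 * (8 * (Lc : ℝ) * C₁ * u₀) * Lc * n)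
          + (4 * ((8 * (Lc : ℝ) * C₁ * u₀) * (8 * (Lc : ℝ) * C₁ * u₀)) + 2 * (4 * ((8 * (Lc : ℝ) * C₁ * u₀) * (8 * (Lc : ℝ) * C₁ * u₀))) * Lc * n)
          + (C₁ * u₀) * (2 * (8 * (Lc : ℝ) * C₁ * u₀) + 2 * (8 * (Lc : ℝ) * C₁ * u₀) * Lc * n))
      + (Tb * q7) * ((C₁ * u₀) * (2 * (8 * (Lc : ℝ) * cΔ * u₀) + 2 * (8 * (Lc : ℝ) * cΔ * u₀) * Lc * n)
          + (4 * ((8 * (Lc : ℝ) * cΔ * u₀) * (8 * (Lc : ℝ) * C₁ * u₀)) + 2 * (4 * ((8 * (Lc : ℝ) * cΔ * u₀) * (8 * (Lc : ℝ) * C₁ * u₀))) * Lc * n)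
          + (cΔ * u₀) * (2 * (8 * (Lc : ℝ) * C₁ * u₀) + 2 * (8 * (Lc : ℝ) * C₁ * u₀) * Lc * n))
      + (Tb * q7) * ((cΔ * u₀) * (2 * (8 * (Lc : ℝ) * C₁ * u₀) + 2 * (8 * (Lc : ℝ) * C₁ * u₀) * Lc * n)
          + (4 * ((8 * (Lc : ℝ) * C₁ * u₀) * (8 * (Lc : ℝ) * cΔ * u₀)) + 2 * (4 * ((8 * (Lc : ℝ) * C₁ * u₀) * (8 * (Lc : ℝ) * cΔ * u₀))) * Lc * n)
          + (C₁ * u₀) * (2 * (8 * (Lc : ℝ) * cΔ * u₀) + 2 * (8 * (Lc : ℝ) * cΔ * u₀) * Lc * n))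
      ≤ (q7 * u₀ ^ 2) * ((2 * Tb * C₁ * cΔ + TΔ * C₁ ^ 2) * (((n : ℝ) + 1) * L3)) := by
    refine le_trans (le_of_eq ?_) hPfm
    abel
  -- the envelopes re-centred at `u′` in `ℓ¹` currency
  have hEXz : Real.exp (-(κ / 12) * (supNorm (x - z) + supNorm (u' - z))) ≤ EXP :=
    (exp_recenter_right_le (c := κ / 12) (by positivity) x z u').trans
      (exp_supNorm_add_le_exp_l1 (d := 3) (c := κ / 12 / 2) (by positivity) (x - u') (z - u'))
  have hEXx : Real.exp (-(κ / 12) * (supNorm (z - x) + supNorm (u' - x))) ≤ EXP :=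
    (exp_recenter_left_le (c := κ / 12) (by positivity) x z u').trans
      (exp_supNorm_add_le_exp_l1 (d := 3) (c := κ / 12 / 2) (by positivity) (x - u') (z - u'))
  -- each pair bound ≤ the same bound with §1's polynomial and the re-centred envelope
  have hPP0 : 0 ≤ (q7 * u₀ ^ 2) * ((2 * Tb * C₁ * cΔ + TΔ * C₁ ^ 2) * (((n : ℝ) + 1) * L3)) := by positivity
  have key : ∀ {EX POLY : ℝ}, 0 ≤ EX → EX ≤ EXP → POLY ≤ (q7 * u₀ ^ 2) * ((2 * Tb * C₁ * cΔ + TΔ * C₁ ^ 2) * (((n : ℝ) + 1) * L3)) →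
      ((Lc : ℝ) ^ (3 + 1))⁻¹ * (K * POLY * (Y4 * ZZ) * EX)
        ≤ ((Lc : ℝ) ^ (3 + 1))⁻¹ * (K * ((q7 * u₀ ^ 2) * ((2 * Tb * C₁ * cΔ + TΔ * C₁ ^ 2) * (((n : ℝ) + 1) * L3))) * (Y4 * ZZ) * EXP) := by
    intro EX POLY hEX0 hEX hPOLY
    refine mul_le_mul_of_nonneg_left ?_ (by positivity)
    calc K * POLY * (Y4 * ZZ) * EX ≤ K * ((q7 * u₀ ^ 2) * ((2 * Tb * C₁ * cΔ + TΔ * C₁ ^ 2) * (((n : ℝ) + 1) * L3))) * (Y4 * ZZ) * EX :=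
          mul_le_mul_of_nonneg_right (mul_le_mul_of_nonneg_right (mul_le_mul_of_nonneg_left hPOLY hK0) (mul_nonneg hY40 hZ)) hEX0
      _ ≤ K * ((q7 * u₀ ^ 2) * ((2 * Tb * C₁ * cΔ + TΔ * C₁ ^ 2) * (((n : ℝ) + 1) * L3))) * (Y4 * ZZ) * EXP :=
          mul_le_mul_of_nonneg_left hEX (mul_nonneg (mul_nonneg hK0 hPP0) (mul_nonneg hY40 hZ))
  refine (mul_le_mul_of_nonneg_left (add_le_add (key (Real.exp_pos _).le hEXx hPmf) (key (Real.exp_pos _).le hEXz hPfm))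
    (by positivity)).trans ?_
  -- the powers: `units_le`
  have hU : W * (q7 * (u₀ ^ 2 * Y4)) ≤ (Lc : ℝ) ^ 3 * ((Lc : ℝ)⁻¹) ^ (n + 1) := by
    have h := units_le (Lc := Lc) hcE n
    rw [hW, hq7, hu₀, hY4]
    exact h
  have hR0 : 0 ≤ |cVH| * (2 * (((Lc : ℝ) ^ (3 + 1))⁻¹ * K * ((2 * Tb * C₁ * cΔ + TΔ * C₁ ^ 2) * L3) * ZZ)) * (((n : ℝ) + 1)) * EXP := by positivity
  calc W * |cVH| *
        (((Lc : ℝ) ^ (3 + 1))⁻¹ * (K * ((q7 * u₀ ^ 2) * ((2 * Tb * C₁ * cΔ + TΔ * C₁ ^ 2) * (((n : ℝ) + 1) * L3))) * (Y4 * ZZ) * EXP)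
          + ((Lc : ℝ) ^ (3 + 1))⁻¹ * (K * ((q7 * u₀ ^ 2) * ((2 * Tb * C₁ * cΔ + TΔ * C₁ ^ 2) * (((n : ℝ) + 1) * L3))) * (Y4 * ZZ) * EXP))
      = (W * (q7 * (u₀ ^ 2 * Y4)))
        * (|cVH| * (2 * (((Lc : ℝ) ^ (3 + 1))⁻¹ * K * ((2 * Tb * C₁ * cΔ + TΔ * C₁ ^ 2) * L3) * ZZ)) * (((n : ℝ) + 1)) * EXP) := by ring
    _ ≤ ((Lc : ℝ) ^ 3 * ((Lc : ℝ)⁻¹) ^ (n + 1))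
        * (|cVH| * (2 * (((Lc : ℝ) ^ (3 + 1))⁻¹ * K * ((2 * Tb * C₁ * cΔ + TΔ * C₁ ^ 2) * L3) * ZZ)) * (((n : ℝ) + 1)) * EXP) :=
      mul_le_mul_of_nonneg_right hU hR0
    _ = _ := by ring

end Summit.QuantumFields.BalabanUV.Beta.GAN24.BornBorderContactPairCount
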